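import Literature.NumberTheory.Automorphic.AdelicTensorStrippingLF
import HarnessLib

/-!
# Adelic tensor stripping — covariant (quotient) form: `M = A_∞ ⊗ M_f`

The QUOTIENT STEP of the tensor decomposition of adelic operators of metaplectic type (Weil assembles the
adelic `𝐫_A(s) = ⊗_v 𝐫_v(s_v)` place by place, [Weil1964, Chap. III n° 37–38 p. 188–190]; the smooth model
`𝒮(X_𝔸) = 𝓢(X_∞) ⊗ 𝒮(X_f)` of [MoeglinVignerasWaldspurger1987, Chap. 2 I.4]).

*Abstract part* (§1, pure linear algebra): if two operators `M`, `E` of a module both intertwine a family of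
operators `U h` (`h ∈ S`) COVARIANTLY through the same relabelling `s` — `M ∘ U h = U (s h) ∘ M` and
`E ∘ U h = U (s h) ∘ E` for `h ∈ S` — `E` is invertible and `s` maps `S` ONTO `S`, then `M ∘ E⁻¹` COMMUTES with
every `U h`, `h ∈ S`.

*Adelic part* (§2–§3): on `𝒮(𝔸_K^ι)`, when the family `U` contains the finite Heisenberg operators `T_(0,k)` and
`M_(0,y)` (`translateLM`, `modulateLM` at finite vectors) and `E = 1 ⊗ M_f` for a linear automorphism `M_f` of
the finite factor `𝒮((𝔸_K^∞)^ι)`, the archimedean tensor stripping theorem `eq_adelicTensorEnd_archPart_id`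
gives `M ∘ (1 ⊗ M_f)⁻¹ = A_∞ ⊗ 1`, i.e. **`M = A_∞ ⊗ M_f`** with `A_∞ = archPart (M ∘ (1 ⊗ M_f⁻¹))`; `A_∞` is
a CONTINUOUS operator of `𝓢((K ⊗ ℝ)^ι)` when `M` is LF-continuous, and a TOPOLOGICAL AUTOMORPHISM when `M` is an
LF-continuous automorphism (`exists_continuousLinearEquiv_eq_adelicTensorEnd_of_covariant`).

No metaplectic group is imported: the family `U : H → End 𝒮(𝔸_K^ι)`, the relabelling `s : H → H` and the index
set `S ⊆ H` are parameters (to be instantiated with the global Schrödinger representation of the adelic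
Heisenberg group, the action `h ↦ g h` of an element `g = (1_∞, g_f)` of the adelic symplectic group, and the set of
finite Heisenberg elements).
-/

open NumberField NumberField.InfinitePlace NumberField.mixedEmbedding IsDedekindDomain

open scoped SchwartzMap TensorProduct Classical

namespace Literature.NumberTheory.Automorphic

/-! ## 1. The abstract quotient step -/

section Abstract

variable {R V H : Type*} [Semiring R] [AddCommMonoid V] [Module R V]

/-- **Quotient of two covariant operators commutes with the family.** If `M ∘ U h = U (s h) ∘ M` and
`E ∘ U h = U (s h) ∘ E` for all `h ∈ S`, `E E' = 1 = E' E`, and `s` maps `S` onto `S`, then `M ∘ E'` commutes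
with `U h` for every `h ∈ S` (`U (s h) = E ∘ U h ∘ E'`, so `M E' U(s h) = M U h E' = U (s h) M E'`). [folklore] -/
theorem comp_comm_of_covariant (U : H → V →ₗ[R] V) (s : H → H) (S : Set H)
    (hs : ∀ h' ∈ S, ∃ h ∈ S, s h = h') {M E E' : V →ₗ[R] V}
    (hEE' : E ∘ₗ E' = LinearMap.id) (hE'E : E' ∘ₗ E = LinearMap.id)
    (hM : ∀ h ∈ S, M ∘ₗ U h = U (s h) ∘ₗ M) (hE : ∀ h ∈ S, E ∘ₗ U h = U (s h) ∘ₗ E)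
    (h' : H) (hh' : h' ∈ S) : (M ∘ₗ E') ∘ₗ U h' = U h' ∘ₗ (M ∘ₗ E') := by
  obtain ⟨h, hh, rfl⟩ := hs h' hh'
  have key : U (s h) = E ∘ₗ U h ∘ₗ E' := by
    rw [← LinearMap.comp_assoc, hE h hh, LinearMap.comp_assoc, hEE', LinearMap.comp_id]
  calc (M ∘ₗ E') ∘ₗ U (s h)
      = M ∘ₗ (E' ∘ₗ E) ∘ₗ U h ∘ₗ E' := by rw [key]; simp only [LinearMap.comp_assoc]
    _ = (M ∘ₗ U h) ∘ₗ E' := by rw [hE'E, LinearMap.id_comp, LinearMap.comp_assoc]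
    _ = U (s h) ∘ₗ (M ∘ₗ E') := by rw [hM h hh, LinearMap.comp_assoc]

/-- The same with the roles of the family members spelled as a conclusion for ALL of `S` at once. [folklore] -/
theorem forall_comp_comm_of_covariant (U : H → V →ₗ[R] V) (s : H → H) (S : Set H)
    (hs : ∀ h' ∈ S, ∃ h ∈ S, s h = h') {M E E' : V →ₗ[R] V}
    (hEE' : E ∘ₗ E' = LinearMap.id) (hE'E : E' ∘ₗ E = LinearMap.id)
    (hM : ∀ h ∈ S, M ∘ₗ U h = U (s h) ∘ₗ M) (hE : ∀ h ∈ S, E ∘ₗ U h = U (s h) ∘ₗ E) :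
    ∀ h ∈ S, (M ∘ₗ E') ∘ₗ U h = U h ∘ₗ (M ∘ₗ E') :=
  fun h hh => comp_comm_of_covariant U s S hs hEE' hE'E hM hE h hh

/-- Pointwise form (hypotheses and conclusion on vectors, as in MVW's condition (A)
`M (ρ h f) = ρ (g h) (M f)`). [cite: MoeglinVignerasWaldspurger1987, Chap. 2 II.1 (A)] -/
theorem apply_comm_of_covariant (U : H → V →ₗ[R] V) (s : H → H) (S : Set H)
    (hs : ∀ h' ∈ S, ∃ h ∈ S, s h = h') {M E E' : V →ₗ[R] V}
    (hEE' : ∀ v, E (E' v) = v) (hE'E : ∀ v, E' (E v) = v)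
    (hM : ∀ h ∈ S, ∀ v, M (U h v) = U (s h) (M v)) (hE : ∀ h ∈ S, ∀ v, E (U h v) = U (s h) (E v))
    (h : H) (hh : h ∈ S) (v : V) : M (E' (U h v)) = U h (M (E' v)) := by
  have := comp_comm_of_covariant U s S hs (M := M) (LinearMap.ext hEE') (LinearMap.ext hE'E)
    (fun h hh => LinearMap.ext (hM h hh)) (fun h hh => LinearMap.ext (hE h hh)) h hh
  exact LinearMap.congr_fun this v

end Abstract

/-! ## 2. The finite tensor factor `1 ⊗ M_f` and the decomposition `M = A_∞ ⊗ M_f` -/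

section PiSchwartzBruhat

variable {K : Type} [Field K] [NumberField K] {ι : Type} [Fintype ι]

/-- `(1 ⊗ M_f) ∘ (1 ⊗ M_f⁻¹) = 1`. [folklore] -/
theorem adelicTensorEnd_id_coe_comp_symm (Mf : FinSB K ι ≃ₗ[ℂ] FinSB K ι) :
    adelicTensorEnd LinearMap.id (Mf : FinSB K ι →ₗ[ℂ] FinSB K ι) ∘ₗ
        adelicTensorEnd LinearMap.id (Mf.symm : FinSB K ι →ₗ[ℂ] FinSB K ι) =
      (LinearMap.id : ↥(piSchwartzBruhat K ι) →ₗ[ℂ] ↥(piSchwartzBruhat K ι)) := by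
  have h : (Mf : FinSB K ι →ₗ[ℂ] FinSB K ι) ∘ₗ (Mf.symm : FinSB K ι →ₗ[ℂ] FinSB K ι) = LinearMap.id :=
    LinearMap.ext fun f => Mf.apply_symm_apply f
  rw [← adelicTensorEnd_comp, LinearMap.id_comp, h, adelicTensorEnd_id]

/-- `(1 ⊗ M_f⁻¹) ∘ (1 ⊗ M_f) = 1`. [folklore] -/
theorem adelicTensorEnd_id_symm_comp_coe (Mf : FinSB K ι ≃ₗ[ℂ] FinSB K ι) :
    adelicTensorEnd LinearMap.id (Mf.symm : FinSB K ι →ₗ[ℂ] FinSB K ι) ∘ₗ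
        adelicTensorEnd LinearMap.id (Mf : FinSB K ι →ₗ[ℂ] FinSB K ι) =
      (LinearMap.id : ↥(piSchwartzBruhat K ι) →ₗ[ℂ] ↥(piSchwartzBruhat K ι)) := by
  have h : (Mf.symm : FinSB K ι →ₗ[ℂ] FinSB K ι) ∘ₗ (Mf : FinSB K ι →ₗ[ℂ] FinSB K ι) = LinearMap.id :=
    LinearMap.ext fun f => Mf.symm_apply_apply f
  rw [← adelicTensorEnd_comp, LinearMap.id_comp, h, adelicTensorEnd_id]

variable (K ι) in
/-- **`1 ⊗ M_f` as a linear automorphism of `𝒮(𝔸_K^ι)`** for a linear automorphism `M_f` of the finite factor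
`𝒮((𝔸_K^∞)^ι)`, with inverse `1 ⊗ M_f⁻¹`. [folklore] -/
noncomputable def adelicTensorAutFin (Mf : FinSB K ι ≃ₗ[ℂ] FinSB K ι) :
    ↥(piSchwartzBruhat K ι) ≃ₗ[ℂ] ↥(piSchwartzBruhat K ι) :=
  LinearEquiv.ofLinear (adelicTensorEnd LinearMap.id (Mf : FinSB K ι →ₗ[ℂ] FinSB K ι))
    (adelicTensorEnd LinearMap.id (Mf.symm : FinSB K ι →ₗ[ℂ] FinSB K ι))
    (adelicTensorEnd_id_coe_comp_symm Mf) (adelicTensorEnd_id_symm_comp_coe Mf)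

/-- `1 ⊗ M_f` as a linear map. [folklore] -/
@[simp] theorem coe_adelicTensorAutFin (Mf : FinSB K ι ≃ₗ[ℂ] FinSB K ι) :
    (adelicTensorAutFin K ι Mf : ↥(piSchwartzBruhat K ι) →ₗ[ℂ] ↥(piSchwartzBruhat K ι)) =
      adelicTensorEnd LinearMap.id (Mf : FinSB K ι →ₗ[ℂ] FinSB K ι) :=
  rfl

/-- `(1 ⊗ M_f)⁻¹ = 1 ⊗ M_f⁻¹` as a linear map. [folklore] -/
@[simp] theorem coe_adelicTensorAutFin_symm (Mf : FinSB K ι ≃ₗ[ℂ] FinSB K ι) :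
    ((adelicTensorAutFin K ι Mf).symm : ↥(piSchwartzBruhat K ι) →ₗ[ℂ] ↥(piSchwartzBruhat K ι)) =
      adelicTensorEnd LinearMap.id (Mf.symm : FinSB K ι →ₗ[ℂ] FinSB K ι) :=
  rfl

/-- `(1 ⊗ M_f)(Φ_∞ ⊗ f) = Φ_∞ ⊗ M_f f`. [folklore] -/
theorem adelicTensorAutFin_apply_tmul (Mf : FinSB K ι ≃ₗ[ℂ] FinSB K ι)
    (Φinf : 𝓢((ι → mixedSpace K), ℂ)) (f : FinSB K ι) :
    adelicTensorAutFin K ι Mf (piSchwartzBruhatEquiv K ι (Φinf ⊗ₜ f)) =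
      piSchwartzBruhatEquiv K ι (Φinf ⊗ₜ Mf f) :=
  adelicTensorEnd_apply_tmul LinearMap.id (Mf : FinSB K ι →ₗ[ℂ] FinSB K ι) Φinf f

/-- `(1 ⊗ M_f⁻¹)((1 ⊗ M_f) Φ) = Φ`. [folklore] -/
@[simp] theorem adelicTensorEnd_id_symm_adelicTensorAutFin_apply (Mf : FinSB K ι ≃ₗ[ℂ] FinSB K ι)
    (Φ : ↥(piSchwartzBruhat K ι)) :
    adelicTensorEnd LinearMap.id (Mf.symm : FinSB K ι →ₗ[ℂ] FinSB K ι) (adelicTensorAutFin K ι Mf Φ) = Φ :=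
  (adelicTensorAutFin K ι Mf).symm_apply_apply Φ

/-- `1 ⊗ M_f` is an LF-continuous automorphism (both it and its inverse are one-term tensor operators with
continuous archimedean factor `1`). [folklore] -/
theorem adelicTensorAutFin_mem_lfUnits (Mf : FinSB K ι ≃ₗ[ℂ] FinSB K ι) :
    adelicTensorAutFin K ι Mf ∈ lfUnits K ι :=
  mem_lfUnits_of_tensor _ (ContinuousLinearMap.id ℂ _) (ContinuousLinearMap.id ℂ _)
    (Mf : FinSB K ι →ₗ[ℂ] FinSB K ι) (Mf.symm : FinSB K ι →ₗ[ℂ] FinSB K ι)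
    (fun Φ => by rw [ContinuousLinearMap.coe_id]; rfl) (fun Φ => by rw [ContinuousLinearMap.coe_id]; rfl)

/-- `M ∘ (1 ⊗ B)` is LF-continuous when `M` is. [folklore] -/
theorem IsLFContinuous.comp_adelicTensorEnd_id {M : ↥(piSchwartzBruhat K ι) →ₗ[ℂ] ↥(piSchwartzBruhat K ι)}
    (hLF : IsLFContinuous M) (B : FinSB K ι →ₗ[ℂ] FinSB K ι) :
    IsLFContinuous (M ∘ₗ adelicTensorEnd LinearMap.id B) := by
  have h := isLFContinuous_adelicTensorEnd (ContinuousLinearMap.id ℂ 𝓢((ι → mixedSpace K), ℂ)) B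
  rw [ContinuousLinearMap.coe_id] at h
  exact hLF.comp h

variable {H : Type*} {U : H → ↥(piSchwartzBruhat K ι) →ₗ[ℂ] ↥(piSchwartzBruhat K ι)} {s : H → H} {S : Set H}
  {M : ↥(piSchwartzBruhat K ι) →ₗ[ℂ] ↥(piSchwartzBruhat K ι)} {Mf : FinSB K ι ≃ₗ[ℂ] FinSB K ι}

/-- **The quotient `M ∘ (1 ⊗ M_f⁻¹)` commutes with the finite translations**, when `M` and `1 ⊗ M_f` are
covariant for a family `U` through the same relabelling `s` of an `s`-stable index set `S` containing (indices
of) all finite translations `T_(0,k)`. [folklore] -/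
theorem comm_translateLM_of_covariant (hs : ∀ h' ∈ S, ∃ h ∈ S, s h = h')
    (hUT : ∀ k : ι → FiniteAdeleRing (𝓞 K) K, ∃ h ∈ S, U h = translateLM K ι (piAdeleSplit K ι (0, k)))
    (hM : ∀ h ∈ S, M ∘ₗ U h = U (s h) ∘ₗ M)
    (hE : ∀ h ∈ S, adelicTensorEnd LinearMap.id (Mf : FinSB K ι →ₗ[ℂ] FinSB K ι) ∘ₗ U h =
      U (s h) ∘ₗ adelicTensorEnd LinearMap.id (Mf : FinSB K ι →ₗ[ℂ] FinSB K ι))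
    (k : ι → FiniteAdeleRing (𝓞 K) K) :
    (M ∘ₗ adelicTensorEnd LinearMap.id (Mf.symm : FinSB K ι →ₗ[ℂ] FinSB K ι)) ∘ₗ
        translateLM K ι (piAdeleSplit K ι (0, k)) =
      translateLM K ι (piAdeleSplit K ι (0, k)) ∘ₗ
        (M ∘ₗ adelicTensorEnd LinearMap.id (Mf.symm : FinSB K ι →ₗ[ℂ] FinSB K ι)) := by
  obtain ⟨h, hh, hUh⟩ := hUT k
  rw [← hUh]
  exact comp_comm_of_covariant U s S hs (adelicTensorEnd_id_coe_comp_symm Mf)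
    (adelicTensorEnd_id_symm_comp_coe Mf) hM hE h hh

/-- **The quotient `M ∘ (1 ⊗ M_f⁻¹)` commutes with the finite modulations** (same hypotheses, with the finite
modulations `M_(0,y)` in the family). [folklore] -/
theorem comm_modulateLM_of_covariant (hs : ∀ h' ∈ S, ∃ h ∈ S, s h = h')
    (hUM : ∀ y : ι → FiniteAdeleRing (𝓞 K) K, ∃ h ∈ S, U h = modulateLM K ι (piAdeleSplit K ι (0, y)))
    (hM : ∀ h ∈ S, M ∘ₗ U h = U (s h) ∘ₗ M)
    (hE : ∀ h ∈ S, adelicTensorEnd LinearMap.id (Mf : FinSB K ι →ₗ[ℂ] FinSB K ι) ∘ₗ U h =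
      U (s h) ∘ₗ adelicTensorEnd LinearMap.id (Mf : FinSB K ι →ₗ[ℂ] FinSB K ι))
    (y : ι → FiniteAdeleRing (𝓞 K) K) :
    (M ∘ₗ adelicTensorEnd LinearMap.id (Mf.symm : FinSB K ι →ₗ[ℂ] FinSB K ι)) ∘ₗ
        modulateLM K ι (piAdeleSplit K ι (0, y)) =
      modulateLM K ι (piAdeleSplit K ι (0, y)) ∘ₗ
        (M ∘ₗ adelicTensorEnd LinearMap.id (Mf.symm : FinSB K ι →ₗ[ℂ] FinSB K ι)) := by
  obtain ⟨h, hh, hUh⟩ := hUM y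
  rw [← hUh]
  exact comp_comm_of_covariant U s S hs (adelicTensorEnd_id_coe_comp_symm Mf)
    (adelicTensorEnd_id_symm_comp_coe Mf) hM hE h hh

/-- **`M = A_∞ ⊗ M_f` (covariant tensor stripping).** If `M` and `1 ⊗ M_f` are covariant for a family `U`
through the same relabelling `s` of an `s`-stable index set `S` containing all finite translations and
modulations, then `M = archPart (M ∘ (1 ⊗ M_f⁻¹)) ⊗ M_f`. [folklore] -/
theorem eq_adelicTensorEnd_archPart_of_covariant (hs : ∀ h' ∈ S, ∃ h ∈ S, s h = h')
    (hUT : ∀ k : ι → FiniteAdeleRing (𝓞 K) K, ∃ h ∈ S, U h = translateLM K ι (piAdeleSplit K ι (0, k)))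
    (hUM : ∀ y : ι → FiniteAdeleRing (𝓞 K) K, ∃ h ∈ S, U h = modulateLM K ι (piAdeleSplit K ι (0, y)))
    (hM : ∀ h ∈ S, M ∘ₗ U h = U (s h) ∘ₗ M)
    (hE : ∀ h ∈ S, adelicTensorEnd LinearMap.id (Mf : FinSB K ι →ₗ[ℂ] FinSB K ι) ∘ₗ U h =
      U (s h) ∘ₗ adelicTensorEnd LinearMap.id (Mf : FinSB K ι →ₗ[ℂ] FinSB K ι)) :
    M = adelicTensorEnd
      (archPart (M ∘ₗ adelicTensorEnd LinearMap.id (Mf.symm : FinSB K ι →ₗ[ℂ] FinSB K ι)))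
      (Mf : FinSB K ι →ₗ[ℂ] FinSB K ι) := by
  have hN := eq_adelicTensorEnd_archPart_id
    (M ∘ₗ adelicTensorEnd LinearMap.id (Mf.symm : FinSB K ι →ₗ[ℂ] FinSB K ι))
    (comm_translateLM_of_covariant hs hUT hM hE) (comm_modulateLM_of_covariant hs hUM hM hE)
  calc M = (M ∘ₗ adelicTensorEnd LinearMap.id (Mf.symm : FinSB K ι →ₗ[ℂ] FinSB K ι)) ∘ₗ
        adelicTensorEnd LinearMap.id (Mf : FinSB K ι →ₗ[ℂ] FinSB K ι) := by
        rw [LinearMap.comp_assoc, adelicTensorEnd_id_symm_comp_coe, LinearMap.comp_id]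
    _ = adelicTensorEnd
          (archPart (M ∘ₗ adelicTensorEnd LinearMap.id (Mf.symm : FinSB K ι →ₗ[ℂ] FinSB K ι)))
          LinearMap.id ∘ₗ adelicTensorEnd LinearMap.id (Mf : FinSB K ι →ₗ[ℂ] FinSB K ι) :=
        congrArg (fun X => X ∘ₗ adelicTensorEnd LinearMap.id (Mf : FinSB K ι →ₗ[ℂ] FinSB K ι)) hN
    _ = _ := by rw [← adelicTensorEnd_comp, LinearMap.comp_id, LinearMap.id_comp]

/-- Pointwise form on pure tensors: `M (Φ_∞ ⊗ f) = A_∞ Φ_∞ ⊗ M_f f`. [folklore] -/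
theorem map_tmul_of_covariant (hs : ∀ h' ∈ S, ∃ h ∈ S, s h = h')
    (hUT : ∀ k : ι → FiniteAdeleRing (𝓞 K) K, ∃ h ∈ S, U h = translateLM K ι (piAdeleSplit K ι (0, k)))
    (hUM : ∀ y : ι → FiniteAdeleRing (𝓞 K) K, ∃ h ∈ S, U h = modulateLM K ι (piAdeleSplit K ι (0, y)))
    (hM : ∀ h ∈ S, M ∘ₗ U h = U (s h) ∘ₗ M)
    (hE : ∀ h ∈ S, adelicTensorEnd LinearMap.id (Mf : FinSB K ι →ₗ[ℂ] FinSB K ι) ∘ₗ U h =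
      U (s h) ∘ₗ adelicTensorEnd LinearMap.id (Mf : FinSB K ι →ₗ[ℂ] FinSB K ι))
    (Φinf : 𝓢((ι → mixedSpace K), ℂ)) (f : FinSB K ι) :
    M (piSchwartzBruhatEquiv K ι (Φinf ⊗ₜ f)) = piSchwartzBruhatEquiv K ι
      (archPart (M ∘ₗ adelicTensorEnd LinearMap.id (Mf.symm : FinSB K ι →ₗ[ℂ] FinSB K ι)) Φinf ⊗ₜ Mf f) := by
  conv_lhs => rw [eq_adelicTensorEnd_archPart_of_covariant hs hUT hUM hM hE]
  rw [adelicTensorEnd_apply_tmul, LinearEquiv.coe_coe]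

/-! ## 3. Continuity of the archimedean factor -/

/-- **`M = A_∞ ⊗ M_f` with `A_∞` CONTINUOUS**, for `M` LF-continuous. [folklore] -/
theorem exists_clm_eq_adelicTensorEnd_of_covariant (hLF : IsLFContinuous M)
    (hs : ∀ h' ∈ S, ∃ h ∈ S, s h = h')
    (hUT : ∀ k : ι → FiniteAdeleRing (𝓞 K) K, ∃ h ∈ S, U h = translateLM K ι (piAdeleSplit K ι (0, k)))
    (hUM : ∀ y : ι → FiniteAdeleRing (𝓞 K) K, ∃ h ∈ S, U h = modulateLM K ι (piAdeleSplit K ι (0, y)))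
    (hM : ∀ h ∈ S, M ∘ₗ U h = U (s h) ∘ₗ M)
    (hE : ∀ h ∈ S, adelicTensorEnd LinearMap.id (Mf : FinSB K ι →ₗ[ℂ] FinSB K ι) ∘ₗ U h =
      U (s h) ∘ₗ adelicTensorEnd LinearMap.id (Mf : FinSB K ι →ₗ[ℂ] FinSB K ι)) :
    ∃ A : 𝓢((ι → mixedSpace K), ℂ) →L[ℂ] 𝓢((ι → mixedSpace K), ℂ),
      M = adelicTensorEnd (A : 𝓢((ι → mixedSpace K), ℂ) →ₗ[ℂ] 𝓢((ι → mixedSpace K), ℂ))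
        (Mf : FinSB K ι →ₗ[ℂ] FinSB K ι) :=
  ⟨archPartCLM _ (hLF.comp_adelicTensorEnd_id _) (comm_translateLM_of_covariant hs hUT hM hE)
      (comm_modulateLM_of_covariant hs hUM hM hE),
    eq_adelicTensorEnd_archPart_of_covariant hs hUT hUM hM hE⟩

/-- **`M = A_∞ ⊗ M_f` with `A_∞` a TOPOLOGICAL AUTOMORPHISM of `𝓢((K ⊗ ℝ)^ι)`**, for `M` an LF-continuous
automorphism of `𝒮(𝔸_K^ι)` (`M ∈ lfUnits`): then also `M⁻¹ = A_∞⁻¹ ⊗ M_f⁻¹`. [folklore] -/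
theorem exists_continuousLinearEquiv_eq_adelicTensorEnd_of_covariant
    (P : ↥(piSchwartzBruhat K ι) ≃ₗ[ℂ] ↥(piSchwartzBruhat K ι)) (hPlf : P ∈ lfUnits K ι)
    (hs : ∀ h' ∈ S, ∃ h ∈ S, s h = h')
    (hUT : ∀ k : ι → FiniteAdeleRing (𝓞 K) K, ∃ h ∈ S, U h = translateLM K ι (piAdeleSplit K ι (0, k)))
    (hUM : ∀ y : ι → FiniteAdeleRing (𝓞 K) K, ∃ h ∈ S, U h = modulateLM K ι (piAdeleSplit K ι (0, y)))
    (hP : ∀ h ∈ S, (P : ↥(piSchwartzBruhat K ι) →ₗ[ℂ] ↥(piSchwartzBruhat K ι)) ∘ₗ U h =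
      U (s h) ∘ₗ (P : ↥(piSchwartzBruhat K ι) →ₗ[ℂ] ↥(piSchwartzBruhat K ι)))
    (hE : ∀ h ∈ S, adelicTensorEnd LinearMap.id (Mf : FinSB K ι →ₗ[ℂ] FinSB K ι) ∘ₗ U h =
      U (s h) ∘ₗ adelicTensorEnd LinearMap.id (Mf : FinSB K ι →ₗ[ℂ] FinSB K ι)) :
    ∃ A : 𝓢((ι → mixedSpace K), ℂ) ≃L[ℂ] 𝓢((ι → mixedSpace K), ℂ),
      (P : ↥(piSchwartzBruhat K ι) →ₗ[ℂ] ↥(piSchwartzBruhat K ι)) =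
          adelicTensorEnd (A : 𝓢((ι → mixedSpace K), ℂ) →ₗ[ℂ] 𝓢((ι → mixedSpace K), ℂ))
            (Mf : FinSB K ι →ₗ[ℂ] FinSB K ι) ∧
        (P.symm : ↥(piSchwartzBruhat K ι) →ₗ[ℂ] ↥(piSchwartzBruhat K ι)) =
          adelicTensorEnd (A.symm : 𝓢((ι → mixedSpace K), ℂ) →ₗ[ℂ] 𝓢((ι → mixedSpace K), ℂ))
            (Mf.symm : FinSB K ι →ₗ[ℂ] FinSB K ι) := by
  -- the quotient `N = M ∘ (1 ⊗ M_f)⁻¹` as an LF-continuous automorphism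
  have hElf := adelicTensorAutFin_mem_lfUnits (K := K) (ι := ι) Mf
  have hNdef : (((adelicTensorAutFin K ι Mf).symm.trans P : ↥(piSchwartzBruhat K ι) ≃ₗ[ℂ]
      ↥(piSchwartzBruhat K ι)) : ↥(piSchwartzBruhat K ι) →ₗ[ℂ] ↥(piSchwartzBruhat K ι)) =
      (P : ↥(piSchwartzBruhat K ι) →ₗ[ℂ] ↥(piSchwartzBruhat K ι)) ∘ₗ
        adelicTensorEnd LinearMap.id (Mf.symm : FinSB K ι →ₗ[ℂ] FinSB K ι) := rfl
  have hPlf' := (mem_lfUnits_iff P).1 hPlf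
  have hElf' := (mem_lfUnits_iff _).1 hElf
  have hN : (adelicTensorAutFin K ι Mf).symm.trans P ∈ lfUnits K ι :=
    (mem_lfUnits_iff _).2
      ⟨(hPlf'.1.comp hElf'.2).congr fun _ => rfl, (hElf'.1.comp hPlf'.2).congr fun Φ => by
        simp only [LinearMap.comp_apply, LinearEquiv.coe_coe, LinearEquiv.symm_trans_apply,
          LinearEquiv.symm_symm]⟩
  obtain ⟨A, hA, hA'⟩ := exists_continuousLinearEquiv_of_mem_lfUnits _ hN
    (fun k => by rw [hNdef]; exact comm_translateLM_of_covariant hs hUT hP hE k)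
    (fun y => by rw [hNdef]; exact comm_modulateLM_of_covariant hs hUM hP hE y)
  rw [hNdef] at hA
  refine ⟨A, ?_, ?_⟩
  · calc (P : ↥(piSchwartzBruhat K ι) →ₗ[ℂ] ↥(piSchwartzBruhat K ι))
        = ((P : ↥(piSchwartzBruhat K ι) →ₗ[ℂ] ↥(piSchwartzBruhat K ι)) ∘ₗ
            adelicTensorEnd LinearMap.id (Mf.symm : FinSB K ι →ₗ[ℂ] FinSB K ι)) ∘ₗ
            adelicTensorEnd LinearMap.id (Mf : FinSB K ι →ₗ[ℂ] FinSB K ι) := by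
          rw [LinearMap.comp_assoc, adelicTensorEnd_id_symm_comp_coe, LinearMap.comp_id]
      _ = adelicTensorEnd (A : 𝓢((ι → mixedSpace K), ℂ) →ₗ[ℂ] 𝓢((ι → mixedSpace K), ℂ)) LinearMap.id ∘ₗ
            adelicTensorEnd LinearMap.id (Mf : FinSB K ι →ₗ[ℂ] FinSB K ι) :=
          congrArg (fun X => X ∘ₗ adelicTensorEnd LinearMap.id (Mf : FinSB K ι →ₗ[ℂ] FinSB K ι)) hA
      _ = _ := by rw [← adelicTensorEnd_comp, LinearMap.comp_id, LinearMap.id_comp]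
  · calc (P.symm : ↥(piSchwartzBruhat K ι) →ₗ[ℂ] ↥(piSchwartzBruhat K ι))
        = adelicTensorEnd LinearMap.id (Mf.symm : FinSB K ι →ₗ[ℂ] FinSB K ι) ∘ₗ
            (((adelicTensorAutFin K ι Mf).symm.trans P).symm :
              ↥(piSchwartzBruhat K ι) →ₗ[ℂ] ↥(piSchwartzBruhat K ι)) := by
          apply LinearMap.ext
          intro Φ
          simp only [LinearMap.comp_apply, LinearEquiv.coe_coe, LinearEquiv.symm_trans_apply,
            LinearEquiv.symm_symm, adelicTensorEnd_id_symm_adelicTensorAutFin_apply]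
      _ = adelicTensorEnd LinearMap.id (Mf.symm : FinSB K ι →ₗ[ℂ] FinSB K ι) ∘ₗ
            adelicTensorEnd (A.symm : 𝓢((ι → mixedSpace K), ℂ) →ₗ[ℂ] 𝓢((ι → mixedSpace K), ℂ))
              LinearMap.id :=
          congrArg (fun X => adelicTensorEnd LinearMap.id (Mf.symm : FinSB K ι →ₗ[ℂ] FinSB K ι) ∘ₗ X) hA'
      _ = _ := by rw [← adelicTensorEnd_comp, LinearMap.comp_id, LinearMap.id_comp]

end PiSchwartzBruhat

end Literature.NumberTheory.Automorphic
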